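import Summits.QuantumFields.YangMills.Theorems.BalabanUVNodesN18ComplexPlaqLetter
import Summits.QuantumFields.YangMills.Theorems.UnitScaleTiltProp8ChartOneStep
import Summits.QuantumFields.YangMills.Theorems.UnitScaleTiltProp7IterLinearisationFlat
import HarnessLib

/-!
# N18 (β)-transport letters: the comb step at a near-identity factorised field — `log(Ū(S)·Ū(U₀)⁻¹)` is the linearised average of `E − 1` to second order

[DAGN18W3-G4 INTENT-9] — count-neutral helper toward K3⁷ `stmt-QuantumFields-20544` (NOT claimed, NOT closed).  YM mass gap (Clay) NOT proved by any of this;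
R4 closes the conditional finite-𝕋⁴ rung `BalabanLadder.UV` only.

WHY (COMB-STEP-DESIGN.md of this seat, §2 steps 2–4).  After g4 the one analytic piece left in N18's closure-ledger item (iii) is the comb step
([Balaban1985Averaging] Prop. 3 (62)–(63), (122)–(126)): a comb generator `l` whose cancelled sum `|A′_A − i∇l|` has leading coefficient `1·α₁`, not the trivial
comb's `176(d+2)·α₁`.  In the unitary axial gauge of the factor `U` the complex field `𝐔 = (exp iηA′)U` becomes a FACTORISED NEAR-IDENTITY field `S = E·U₀`
(`‖E(b) − 1‖ ≤ e ≈ 2ηα₁`, `‖U₀(b) − 1‖ ≤ t ≈ Rα₀η²`), and `A′_A = (iξ)⁻¹·Ad(u⁻¹)·log(Ū(S)Ū(U₀)⁻¹)`.  THIS FILE proves the analytic core for such fields, from the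
tree's flat-background Prop. 3 (`UnitScaleTiltProp8ChartOneStep.norm_emlAvgU_sub_one_sub_linAvg_le`, UST seat; `Prop8Chart.emlAvgU = W1.avgUnits` is `rfl`):
`‖log(Ū(S)(c)·Ū(U₀)(c)⁻¹) − (Q₁(E − 1))(c)‖ ≤ C·ℓ²(e + t)²`-type (explicit), where `Q₁ = BlockAveragingEMLLinearised.linAvg` DECOMPOSES as
`Q₁Y(c) = L·(QY)(c) − (λ̄_Y(c₊) − λ̄_Y(c₋))` (`linAvg_eq_bondAvg_sub_grad_combMean`, `λ̄ = combMean` = the linearised comb gauge (62)): the straight-line mean `L·QY`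
is the part with coefficient `1` (`L` bonds of size `η|A′|`, divided by `ξ = Lη`), the comb gradient is what `l` removes.
* §1 `norm_units_inv_le_of_norm_sub_one_le` (Neumann series: `‖u − 1‖ ≤ p ≤ 1∕2 ⇒ ‖u⁻¹‖ ≤ 2`, `‖u⁻¹ − 1‖ ≤ 2p`), `walkSum_smul`, `linAvg_smul`;
* §2 ★ `norm_mlog_avgUnits_mul_inv_sub_linAvg_le` (the estimate above), `norm_linAvg_expI_sub_smul_le` (`Q₁(e^{iηA} − 1) = iη·Q₁A + O(3ℓ(ηa)²)`),
  ★★ `norm_potential_sub_linAvg_le` (`‖(iξ)⁻¹ log(Ū(S)Ū(U₀)⁻¹) − (η∕ξ)·Q₁A‖ ≤ (…)/ξ` for `E = exp iηA`).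
What is NOT here (successor): the axial-gauge reduction of run B's pair to such an `S`, the covariant comb `l` as a definition on run-A sites, and the C¹ letter.

0 `def`, 0 `sorry`.  References: T. Bałaban, CMP **98** (1985) 17–51 [Balaban1985Averaging] (Prop. 3 (62)–(63) p.28, (122)–(126) p.36); CMP **109** (1987) 249–301
[Balaban1987RG1] ((0.4) p.253, (1.13) p.262).
-/

noncomputable section

open scoped BigOperators Matrix.Norms.L2Operator
open NormedSpace

namespace YMDAG.N18.TransportOfRecord

open Complex (I)
open Literature.MathematicalPhysics.QuantumFieldTheory.Balaban1983to89
open Literature.MathematicalPhysics.QuantumFieldTheory.Balaban1983to89.T4Continuum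
open Literature.MathematicalPhysics.QuantumFieldTheory.Balaban1983to89.BlockAveraging
open Literature.MathematicalPhysics.QuantumFieldTheory.Balaban1983to89.BlockAveragingEMLLinearised (walkSum walkSum_nil walkSum_cons linAvg linAvg_def)
open Literature.MathematicalPhysics.QuantumFieldTheory.Balaban1983to89.B12RegularSpaces111 (expI)
open Literature.MathematicalPhysics.QuantumFieldTheory.Balaban1983to89.B12Lemma4Concrete (val_expI)
open Literature.MathematicalPhysics.QuantumFieldTheory.Balaban1983to89.B12Membership314 (norm_I_mul_smul)
open Literature.MathematicalPhysics.QuantumFieldTheory.Balaban1983to89.MatrixLog (mlog)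
open Literature.MathematicalPhysics.QuantumFieldTheory.Balaban1983to89.B7Prop1Explicit (expRem expRem_le_sq norm_mlog_sub_le)
open Literature.MathematicalPhysics.QuantumFieldTheory.Balaban1983to89.Node00.W1 (avgUnits)
open Summit.QuantumFields.YangMills.Theorems.Prop8Chart (norm_emlAvgU_sub_one_sub_linAvg_le norm_exp_sub_one_sub_le_sq)
open Summit.QuantumFields.YangMills.Theorems.Prop7AvgLinearisation (linAvg_sub norm_linAvg_le)

/-! ## §1 Inverses near `1`; scalar linearity of `Q₁` -/

section Small

variable {𝔸 : Type*} [NormedRing 𝔸] [CompleteSpace 𝔸] [NormOneClass 𝔸]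

/-- **Inverses near `1` (Neumann series)**: `‖u − 1‖ ≤ p ≤ 1∕2 ⇒ ‖u⁻¹‖ ≤ 2` and `‖u⁻¹ − 1‖ ≤ 2p` (`u⁻¹ = Σ(1 − u)ⁿ`, `Units.oneSub`). [folklore] -/
theorem norm_units_inv_le_of_norm_sub_one_le {u : 𝔸ˣ} {p : ℝ} (hu : ‖(u : 𝔸) - 1‖ ≤ p) (hp : p ≤ 1 / 2) :
    ‖((u⁻¹ : 𝔸ˣ) : 𝔸)‖ ≤ 2 ∧ ‖((u⁻¹ : 𝔸ˣ) : 𝔸) - 1‖ ≤ 2 * p := by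
  set t : 𝔸 := 1 - (u : 𝔸) with ht
  have htn : ‖t‖ ≤ p := by rw [ht, norm_sub_rev]; exact hu
  have ht1 : ‖t‖ < 1 := by linarith
  have hv : Units.oneSub t ht1 = u := Units.ext (by rw [Units.val_oneSub, ht, sub_sub_cancel])
  have hinv : ‖((u⁻¹ : 𝔸ˣ) : 𝔸)‖ ≤ 2 := by
    rw [← hv]
    have h2 := tsum_geometric_le_of_norm_lt_one t ht1
    have h3 : (1 - ‖t‖)⁻¹ ≤ 2 := (inv_le_comm₀ (by linarith) two_pos).2 (by linarith)
    change ‖∑' n : ℕ, t ^ n‖ ≤ 2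
    rw [norm_one] at h2
    linarith
  refine ⟨hinv, ?_⟩
  have h : ((u⁻¹ : 𝔸ˣ) : 𝔸) - 1 = ((u⁻¹ : 𝔸ˣ) : 𝔸) * t := by rw [ht, mul_sub, mul_one, Units.inv_mul]
  rw [h]
  exact (norm_mul_le _ _).trans (by nlinarith [norm_nonneg ((u⁻¹ : 𝔸ˣ) : 𝔸), norm_nonneg t])

end Small

section Linear

variable {P : Params} {j : ℕ} {n : Type*} [Fintype n] [DecidableEq n]

omit [Fintype n] [DecidableEq n] in
/-- Signed sums along a walk are linear under scalars. [cite: Balaban1984PropagatorsI, (1.8) p.19 (bookkeeping)] -/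
theorem walkSum_smul (κ : ℂ) (Y : PBond P j → Matrix n n ℂ) :
    ∀ γ : List (LStep P j), walkSum (fun b => κ • Y b) γ = κ • walkSum Y γ
  | [] => by simp
  | s :: γ => by
    rw [walkSum_cons, walkSum_cons, walkSum_smul κ Y γ, smul_add]
    split_ifs <;> simp [smul_neg]

omit [Fintype n] [DecidableEq n] in
/-- The linearised one-step average is linear under scalars. [cite: Balaban1985Averaging, (124)-(125) p.36] -/
theorem linAvg_smul (κ : ℂ) (Y : PBond P j → Matrix n n ℂ) (c : PBond P (j + 1)) :
    linAvg (fun b => κ • Y b) c = κ • linAvg Y c := by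
  simp only [linAvg_def, walkSum_smul, ← smul_add, ← smul_sub, ← Finset.smul_sum]
  rw [smul_comm]

end Linear

/-! ## §2 The near-identity factorised one step -/

section NearIdentity

variable {P : Params} {j : ℕ} {n : Type*} [Fintype n] [DecidableEq n] [Nonempty n]

/-- ★ **THE COMB STEP AT A NEAR-IDENTITY FACTORISED FIELD** ([Balaban1985Averaging] Prop. 3 at the flat background, twice): for `S = E·U₀` (bondwise) with
`‖E(b) − 1‖ ≤ e`, `‖U₀(b) − 1‖ ≤ t` on all bonds and `136ℓ(s + t) ≤ 1`, `s = e + t + et` (`ℓ = (d+2)L`),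
`‖log(Ū(S)(c)·Ū(U₀)(c)⁻¹) − (Q₁(E − 1))(c)‖ ≤ 4(34ℓ(s+t))² + 578ℓ²(s+t)t + 660ℓ²(s² + t²) + 3ℓ·e·t`
(`Ū = W1.avgUnits = Prop8Chart.emlAvgU`, `Q₁ = linAvg`; `Ū(S)Ū(U₀)⁻¹ − 1 = (Ū(S) − Ū(U₀))Ū(U₀)⁻¹`, `log(1+Z) = Z + O(Z²)`, `Q₁` linear, `(S−1) − (U₀−1) − (E−1) = (E−1)(U₀−1)`).
[cite: Balaban1985Averaging, Prop. 3 (122)-(126) p.36 and (62)-(63) p.28] -/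
theorem norm_mlog_avgUnits_mul_inv_sub_linAvg_le (hj : j + 1 ≤ P.m + P.K) {E U₀ S : GaugeField P j (Matrix n n ℂ)ˣ}
    (hS : ∀ b, S b = E b * U₀ b) {e t : ℝ} (he0 : 0 ≤ e) (ht0 : 0 ≤ t)
    (hE : ∀ b, ‖((E b : (Matrix n n ℂ)ˣ) : Matrix n n ℂ) - 1‖ ≤ e) (hU : ∀ b, ‖((U₀ b : (Matrix n n ℂ)ˣ) : Matrix n n ℂ) - 1‖ ≤ t)
    (hℓ : 136 * (((P.d + 2) * P.L : ℕ) : ℝ) * ((e + t + e * t) + t) ≤ 1) (c : PBond P (j + 1)) :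
    ‖mlog (((avgUnits S c : (Matrix n n ℂ)ˣ) : Matrix n n ℂ) * (((avgUnits U₀ c)⁻¹ : (Matrix n n ℂ)ˣ) : Matrix n n ℂ)) -
        linAvg (fun b => ((E b : (Matrix n n ℂ)ˣ) : Matrix n n ℂ) - 1) c‖ ≤
      4 * (34 * (((P.d + 2) * P.L : ℕ) : ℝ) * ((e + t + e * t) + t)) ^ 2 + 578 * (((P.d + 2) * P.L : ℕ) : ℝ) ^ 2 * ((e + t + e * t) + t) * t +
        660 * (((P.d + 2) * P.L : ℕ) : ℝ) ^ 2 * ((e + t + e * t) ^ 2 + t ^ 2) + 3 * (((P.d + 2) * P.L : ℕ) : ℝ) * (e * t) := by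
  set ℓ : ℝ := (((P.d + 2) * P.L : ℕ) : ℝ) with hℓdef
  set s : ℝ := e + t + e * t with hs
  have hℓ1 : (1 : ℝ) ≤ ℓ := by
    rw [hℓdef]; exact_mod_cast Nat.one_le_iff_ne_zero.mpr (Nat.mul_ne_zero (by omega) (by have := P.hL.2; omega))
  have hs0 : 0 ≤ s := by positivity
  have hst : t ≤ s := by rw [hs]; nlinarith
  -- `S` is within `s` of `1`
  have hSb : ∀ b, ‖((S b : (Matrix n n ℂ)ˣ) : Matrix n n ℂ) - 1‖ ≤ s := fun b => by
    rw [hS b, Units.val_mul]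
    have hid : ((E b : (Matrix n n ℂ)ˣ) : Matrix n n ℂ) * ((U₀ b : (Matrix n n ℂ)ˣ) : Matrix n n ℂ) - 1 =
        (((E b : (Matrix n n ℂ)ˣ) : Matrix n n ℂ) - 1) * (((U₀ b : (Matrix n n ℂ)ˣ) : Matrix n n ℂ) - 1) +
          ((((E b : (Matrix n n ℂ)ˣ) : Matrix n n ℂ) - 1) + (((U₀ b : (Matrix n n ℂ)ˣ) : Matrix n n ℂ) - 1)) := by noncomm_ring
    rw [hid]
    calc _ ≤ ‖(((E b : (Matrix n n ℂ)ˣ) : Matrix n n ℂ) - 1) * (((U₀ b : (Matrix n n ℂ)ˣ) : Matrix n n ℂ) - 1)‖ +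
          ‖(((E b : (Matrix n n ℂ)ˣ) : Matrix n n ℂ) - 1) + (((U₀ b : (Matrix n n ℂ)ˣ) : Matrix n n ℂ) - 1)‖ := norm_add_le _ _
      _ ≤ e * t + (e + t) := add_le_add ((norm_mul_le _ _).trans (mul_le_mul (hE b) (hU b) (norm_nonneg _) he0))
          ((norm_add_le _ _).trans (add_le_add (hE b) (hU b)))
      _ = s := by rw [hs]; ring
  -- the two flat-background Prop. 3's
  have h48s : 48 * ℓ * s ≤ 1 := by nlinarith
  have h48t : 48 * ℓ * t ≤ 1 := by nlinarith
  obtain ⟨hX1, hX2⟩ := norm_emlAvgU_sub_one_sub_linAvg_le hj (S := S) c hs0 h48s (fun b _ _ => hSb b)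
  obtain ⟨hY1, hY2⟩ := norm_emlAvgU_sub_one_sub_linAvg_le hj (S := U₀) c ht0 h48t (fun b _ _ => hU b)
  -- names
  set A : Matrix n n ℂ := ((avgUnits S c : (Matrix n n ℂ)ˣ) : Matrix n n ℂ) with hA
  set B : Matrix n n ℂ := ((avgUnits U₀ c : (Matrix n n ℂ)ˣ) : Matrix n n ℂ) with hB
  set Binv : Matrix n n ℂ := (((avgUnits U₀ c)⁻¹ : (Matrix n n ℂ)ˣ) : Matrix n n ℂ) with hBinv
  change ‖A - 1 - linAvg _ c‖ ≤ _ at hX1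
  change ‖A - 1‖ ≤ _ at hX2
  change ‖B - 1 - linAvg _ c‖ ≤ _ at hY1
  change ‖B - 1‖ ≤ _ at hY2
  set LS := linAvg (fun b => ((S b : (Matrix n n ℂ)ˣ) : Matrix n n ℂ) - 1) c with hLS
  set LU := linAvg (fun b => ((U₀ b : (Matrix n n ℂ)ˣ) : Matrix n n ℂ) - 1) c with hLU
  set LE := linAvg (fun b => ((E b : (Matrix n n ℂ)ˣ) : Matrix n n ℂ) - 1) c with hLE
  -- the inverse
  have hq : 17 * ℓ * t ≤ 1 / 2 := by nlinarith
  obtain ⟨hBi1, hBi2⟩ := norm_units_inv_le_of_norm_sub_one_le (u := avgUnits U₀ c) hY2 hq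
  change ‖Binv‖ ≤ 2 at hBi1
  change ‖Binv - 1‖ ≤ 2 * (17 * ℓ * t) at hBi2
  -- `A·B⁻¹ − 1 = (A − B)·B⁻¹ =: Z`
  have hBB : B * Binv = 1 := by rw [hB, hBinv, Units.mul_inv]
  set Z : Matrix n n ℂ := (A - B) * Binv with hZ
  have hABZ : A * Binv = 1 + Z := by rw [hZ, sub_mul, hBB]; abel
  -- sizes
  have hAB : ‖A - B‖ ≤ 17 * ℓ * (s + t) := by
    have : A - B = (A - 1) - (B - 1) := by abel
    rw [this]; exact (norm_sub_le _ _).trans (by linarith)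
  have hZn : ‖Z‖ ≤ 34 * ℓ * (s + t) := by
    rw [hZ]; exact (norm_mul_le _ _).trans (by nlinarith [norm_nonneg (A - B), mul_le_mul hAB hBi1 (norm_nonneg _) (by positivity)])
  have hZ1 : 2 * ‖Z‖ ≤ 1 := by nlinarith
  -- `log(1 + Z) = Z + O(Z²)`
  have hlog : ‖mlog (1 + Z) - Z‖ ≤ 4 * (34 * ℓ * (s + t)) ^ 2 := by
    have h := norm_mlog_sub_le (W := 1 + Z) (by rw [add_sub_cancel_left]; linarith)
    rw [add_sub_cancel_left] at h
    refine h.trans ((expRem_le_sq (by positivity) hZ1).trans ?_)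
    nlinarith [norm_nonneg Z]
  -- `Z − (A − B) = (A − B)(B⁻¹ − 1)`
  have hZAB : ‖Z - (A - B)‖ ≤ 578 * ℓ ^ 2 * (s + t) * t := by
    have : Z - (A - B) = (A - B) * (Binv - 1) := by rw [hZ, mul_sub, mul_one]
    rw [this]
    refine (norm_mul_le _ _).trans ?_
    calc ‖A - B‖ * ‖Binv - 1‖ ≤ (17 * ℓ * (s + t)) * (2 * (17 * ℓ * t)) := mul_le_mul hAB hBi2 (norm_nonneg _) (by positivity)
      _ = 578 * ℓ ^ 2 * (s + t) * t := by ring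
  -- `(A − B) − LE = (A − 1 − LS) − (B − 1 − LU) + (LS − LU − LE)`, `LS − LU − LE = Q₁((E−1)(U₀−1))`
  have hD : LS - LU - LE = linAvg (fun b => (((E b : (Matrix n n ℂ)ˣ) : Matrix n n ℂ) - 1) * ((((U₀ b : (Matrix n n ℂ)ˣ) : Matrix n n ℂ)) - 1)) c := by
    rw [hLS, hLU, hLE, ← linAvg_sub, ← linAvg_sub]
    congr 1
    funext b
    rw [hS b, Units.val_mul]
    noncomm_ring
  have hDn : ‖LS - LU - LE‖ ≤ 3 * ℓ * (e * t) := by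
    rw [hD]
    exact norm_linAvg_le _ (mul_nonneg he0 ht0) (fun b => (norm_mul_le _ _).trans (mul_le_mul (hE b) (hU b) (norm_nonneg _) he0)) c
  have hABE : ‖(A - B) - LE‖ ≤ 660 * ℓ ^ 2 * s ^ 2 + 660 * ℓ ^ 2 * t ^ 2 + 3 * ℓ * (e * t) := by
    have : (A - B) - LE = ((A - 1 - LS) - (B - 1 - LU)) + (LS - LU - LE) := by abel
    rw [this]
    exact (norm_add_le _ _).trans (add_le_add ((norm_sub_le _ _).trans (add_le_add hX1 hY1)) hDn)
  -- assemble
  rw [hABZ]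
  have hsplit : mlog (1 + Z) - LE = (mlog (1 + Z) - Z) + (Z - (A - B)) + ((A - B) - LE) := by abel
  rw [hsplit]
  calc _ ≤ ‖mlog (1 + Z) - Z‖ + ‖Z - (A - B)‖ + ‖(A - B) - LE‖ := norm_add₃_le
    _ ≤ 4 * (34 * ℓ * (s + t)) ^ 2 + 578 * ℓ ^ 2 * (s + t) * t + (660 * ℓ ^ 2 * s ^ 2 + 660 * ℓ ^ 2 * t ^ 2 + 3 * ℓ * (e * t)) :=
        add_le_add (add_le_add hlog hZAB) hABE
    _ = _ := by ring

omit [Nonempty n] in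
/-- **The chart factor linearised inside `Q₁`**: for `E(b) = exp iηA(b)` with `|A(b)| ≤ a`, `ηa ≤ 1`: `‖Q₁(E − 1)(c) − iη·(Q₁A)(c)‖ ≤ 3ℓ·(ηa)²`
(`‖e^Y − 1 − Y‖ ≤ ‖Y‖²`, `Q₁` linear with `‖Q₁Y‖ ≤ 3ℓ·sup|Y|`). [cite: Balaban1985Averaging, (124)-(125) p.36; Balaban1987RG1, (1.13) p.262] -/
theorem norm_linAvg_expI_sub_smul_le {η a : ℝ} (hη : 0 ≤ η) (A : PBond P j → Matrix n n ℂ) (hA : ∀ b, ‖A b‖ ≤ a) (hηa : η * a ≤ 1)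
    (c : PBond P (j + 1)) :
    ‖linAvg (fun b => ((expI η (A b) : (Matrix n n ℂ)ˣ) : Matrix n n ℂ) - 1) c - (I * (η : ℂ)) • linAvg A c‖ ≤
      3 * (((P.d + 2) * P.L : ℕ) : ℝ) * (η * a) ^ 2 := by
  rw [← linAvg_smul, ← linAvg_sub]
  refine norm_linAvg_le _ (sq_nonneg _) (fun b => ?_) c
  have hY : ‖(I * (η : ℂ)) • A b‖ ≤ η * a := by rw [norm_I_mul_smul hη]; exact mul_le_mul_of_nonneg_left (hA b) hη
  have h := (norm_exp_sub_one_sub_le_sq (Y := (I * (η : ℂ)) • A b) (hY.trans hηa)).2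
  rw [val_expI]
  exact h.trans (pow_le_pow_left₀ (norm_nonneg _) hY 2)

/-- ★★ **THE POTENTIAL OF THE AVERAGED FACTORISED FIELD IS THE LINEARISED AVERAGE OF `A` TO SECOND ORDER**: for `S = (exp iηA)·U₀` with `|A| ≤ a`,
`‖U₀ − 1‖ ≤ t` on all bonds, `ηa ≤ 1∕2`, `136ℓ(s + t) ≤ 1` (`s = 2ηa + t + 2ηa·t`) and `ξ > 0`:
`‖(iξ)⁻¹ log(Ū(S)(c)Ū(U₀)(c)⁻¹) − (η∕ξ)·(Q₁A)(c)‖ ≤ [★'s bound at e = 2ηa + 3ℓ(ηa)²]∕ξ`; and `Q₁A(c) = L·(QA)(c) − (λ̄_A(c₊) − λ̄_A(c₋))`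
(`linAvg_eq_bondAvg_sub_grad_combMean`) exhibits the straight-line mean (coefficient `Lη∕ξ = 1` at `ξ = Lη`) and the comb gradient the generator `l` removes.
[cite: Balaban1985Averaging, Prop. 3 (62)-(63) p.28, (122)-(126) p.36; Balaban1987RG1, (0.4) p.253, (1.13) p.262] -/
theorem norm_potential_sub_linAvg_le (hj : j + 1 ≤ P.m + P.K) {U₀ S : GaugeField P j (Matrix n n ℂ)ˣ} {A : PBond P j → Matrix n n ℂ} {η ξ a t : ℝ}
    (hη : 0 ≤ η) (hξ : 0 < ξ) (hS : ∀ b, S b = expI η (A b) * U₀ b) (ha0 : 0 ≤ a) (hA : ∀ b, ‖A b‖ ≤ a) (hηa : η * a ≤ 1 / 2) (ht0 : 0 ≤ t)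
    (hU : ∀ b, ‖((U₀ b : (Matrix n n ℂ)ˣ) : Matrix n n ℂ) - 1‖ ≤ t)
    (hℓ : 136 * (((P.d + 2) * P.L : ℕ) : ℝ) * ((2 * (η * a) + t + 2 * (η * a) * t) + t) ≤ 1) (c : PBond P (j + 1)) :
    ‖(I * (ξ : ℂ))⁻¹ • mlog (((avgUnits S c : (Matrix n n ℂ)ˣ) : Matrix n n ℂ) * (((avgUnits U₀ c)⁻¹ : (Matrix n n ℂ)ˣ) : Matrix n n ℂ)) -
        ((η / ξ : ℝ) : ℂ) • linAvg A c‖ ≤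
      (4 * (34 * (((P.d + 2) * P.L : ℕ) : ℝ) * ((2 * (η * a) + t + 2 * (η * a) * t) + t)) ^ 2 +
        578 * (((P.d + 2) * P.L : ℕ) : ℝ) ^ 2 * ((2 * (η * a) + t + 2 * (η * a) * t) + t) * t +
        660 * (((P.d + 2) * P.L : ℕ) : ℝ) ^ 2 * ((2 * (η * a) + t + 2 * (η * a) * t) ^ 2 + t ^ 2) +
        3 * (((P.d + 2) * P.L : ℕ) : ℝ) * (2 * (η * a) * t) + 3 * (((P.d + 2) * P.L : ℕ) : ℝ) * (η * a) ^ 2) / ξ := by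
  have he : ∀ b, ‖((expI η (A b) : (Matrix n n ℂ)ˣ) : Matrix n n ℂ) - 1‖ ≤ 2 * (η * a) := fun b =>
    (norm_coe_expI_sub_one_le hη ((mul_le_mul_of_nonneg_left (hA b) hη).trans (by linarith))).trans (by nlinarith [hA b])
  have h1 := norm_mlog_avgUnits_mul_inv_sub_linAvg_le hj (E := fun b => expI η (A b)) hS (by positivity) ht0 he hU hℓ c
  have h2 := norm_linAvg_expI_sub_smul_le hη A hA (by linarith) c
  set M := mlog (((avgUnits S c : (Matrix n n ℂ)ˣ) : Matrix n n ℂ) * (((avgUnits U₀ c)⁻¹ : (Matrix n n ℂ)ˣ) : Matrix n n ℂ)) with hM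
  set LE := linAvg (fun b => ((expI η (A b) : (Matrix n n ℂ)ˣ) : Matrix n n ℂ) - 1) c with hLE
  have h12 : ‖M - (I * (η : ℂ)) • linAvg A c‖ ≤
      4 * (34 * (((P.d + 2) * P.L : ℕ) : ℝ) * ((2 * (η * a) + t + 2 * (η * a) * t) + t)) ^ 2 +
        578 * (((P.d + 2) * P.L : ℕ) : ℝ) ^ 2 * ((2 * (η * a) + t + 2 * (η * a) * t) + t) * t +
        660 * (((P.d + 2) * P.L : ℕ) : ℝ) ^ 2 * ((2 * (η * a) + t + 2 * (η * a) * t) ^ 2 + t ^ 2) +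
        3 * (((P.d + 2) * P.L : ℕ) : ℝ) * (2 * (η * a) * t) + 3 * (((P.d + 2) * P.L : ℕ) : ℝ) * (η * a) ^ 2 := by
    have : M - (I * (η : ℂ)) • linAvg A c = (M - LE) + (LE - (I * (η : ℂ)) • linAvg A c) := by abel
    rw [this]
    exact (norm_add_le _ _).trans (add_le_add h1 h2)
  -- divide by `iξ`
  have hIξ : (I * (ξ : ℂ)) ≠ 0 := mul_ne_zero Complex.I_ne_zero (by exact_mod_cast hξ.ne')
  have hscal : ((η / ξ : ℝ) : ℂ) • linAvg A c = (I * (ξ : ℂ))⁻¹ • ((I * (η : ℂ)) • linAvg A c) := by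
    rw [smul_smul]; congr 1; field_simp; push_cast; ring
  rw [hscal, ← smul_sub, norm_smul, norm_inv, norm_mul, Complex.norm_I, one_mul, Complex.norm_real, Real.norm_of_nonneg hξ.le,
    ← div_eq_inv_mul]
  exact div_le_div_of_nonneg_right h12 hξ.le

end NearIdentity

end YMDAG.N18.TransportOfRecord

end
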